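import Summits.CriticalPhenomena.PercolationContinuityZ3.Theorems.Transplant.TriFilmSKc1U
import Summits.CriticalPhenomena.PercolationContinuityZ3.Theorems.Transplant.TriFilmSKc1T00
import Summits.CriticalPhenomena.PercolationContinuityZ3.Theorems.Transplant.TriFilmSKc1T11
import Summits.CriticalPhenomena.PercolationContinuityZ3.Theorems.Transplant.TriFilmSKc1T22
import Summits.CriticalPhenomena.PercolationContinuityZ3.Theorems.Transplant.TriFilmSKc1T0p
import Summits.CriticalPhenomena.PercolationContinuityZ3.Theorems.Transplant.TriFilmSKc1T1p
import Summits.CriticalPhenomena.PercolationContinuityZ3.Theorems.Transplant.TriFilmSKc1T2p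
import Summits.CriticalPhenomena.PercolationContinuityZ3.Theorems.Transplant.TriFilmSKc1S00
import Summits.CriticalPhenomena.PercolationContinuityZ3.Theorems.Transplant.TriFilmSKc1S11
import Summits.CriticalPhenomena.PercolationContinuityZ3.Theorems.Transplant.TriFilmSKc1S22
import Summits.CriticalPhenomena.PercolationContinuityZ3.Theorems.Transplant.TriFilmSKc1S0p
import Summits.CriticalPhenomena.PercolationContinuityZ3.Theorems.Transplant.TriFilmSKc1S1p
import Summits.CriticalPhenomena.PercolationContinuityZ3.Theorems.Transplant.TriFilmSKc1S2p
import Summits.CriticalPhenomena.PercolationContinuityZ3.Theorems.Transplant.HexShadowVLinkageNode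
import Summits.CriticalPhenomena.PercolationContinuityZ3.Theorems.Transplant.TriFilmZero
import Summits.CriticalPhenomena.PercolationContinuityZ3.Theorems.Transplant.TriFilmLinkage
import HarnessLib

/-!
# Triangular film `𝕋 × {0..1}` — ASSEMBLY: `ShapedLinkage 3 (TriFilm.hexShadow 1)` and `θ_v(p_c) = 0` on `𝕋 × {0..1}` WITHOUT p205010

builds on p205010 (kernel theorem, internal audit signed; external expert review pending) — NOT used in this file or anywhere in this chain.  Lane `prim-bschramm`,
seat `prim-bschramm-p2` (gen 39; class C1b; memo `HOME/bschramm/P2-LATTICES.md` §138); helper file (`--supports stmt-CriticalPhenomena-4575 --as helper`).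
For every block centre `z` and all node parameters (13 block shapes: unclipped, `t`-clipped `t_R ∈ {0,1,2}` with `t_D = t_R` or `t_D > t_R`, `s`-clipped likewise)
the kernel-certified case «TriFilmSKc1··» supplies the cleared set (the full lifted block) and the swap pairs («TriFilmSKCase».`linkage_of_caseOK`):
**`TriFilm.shapedLinkage_three_k1`**; the generic consumer «HexShadowVLinkageNode».`TriFilm.theta_criticalProb_eq_zero_of_shapedLinkage` (DST's Gluing Lemma 6
in hexagonal geometry, Fact 2 by located vertex-set surgeries) then gives **`TriFilm.theta_criticalProb_eq_zero_k1`** — the by-name closure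
«TriFilmCriticalContinuityAll» goes through p205010, this one does not.
[cite: DuminilCopinSidoraviciusTassion2016, Thm. 1, §2.3 (proof of Fact 2: the radius R)] [cite: BenjaminiSchramm1996, Conj. 4 / Question 3]
-/

noncomputable section

namespace Summit.CriticalPhenomena.PercolationContinuityZ3.Theorems.Transplant

open Literature.Probability.Percolation Literature.Probability.LatticeModels SimpleGraph
open scoped Classical

namespace TriFilm.SKT

/-- The node clause at every block of `𝕋 × {0..1}`, by block shape (13 covered cases, radius 3). [cite: DuminilCopinSidoraviciusTassion2016, §2.3 (proof of Fact 2)] -/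
theorem linkage_1 (z : Site 2) (tR tD sR sD : ℕ) (htD : tR ≤ tD) (hsD : sR ≤ sD) (hone : 3 ≤ tR ∨ 3 ≤ sR) :
    ∃ W : Set (triFilm 1), (∀ x ∈ W, (TriFilm.hexShadow 1).sh x ∈ blkR 3 z tD sD) ∧
      (∀ x, (TriFilm.hexShadow 1).sh x ∈ hexBall z 1 → (TriFilm.hexShadow 1).sh x ∈ blkR 3 z tD sD → x ∈ W) ∧
        ∀ (E₁ E₂ w' : triFilm 1), (TriFilm.hexShadow 1).Terminals 3 z tR tD sR W E₁ E₂ w' →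
          ∃ r₁ r₂ : VRouteData (TriFilm.film 1) (W ∩ (TriFilm.hexShadow 1).lift (blkR 3 z tR sR)) W E₁ E₂ w', r₁.y = r₂.b ∧ r₁.b = r₂.y := by
  rcases Nat.lt_or_ge tR 3 with htR3 | htR3
  · have hsR3 : 3 ≤ sR := by omega
    interval_cases tR
    · rcases Nat.lt_or_ge tD 1 with htD1 | htD1
      · exact ⟨_, linkage_of_caseOK caseOK_1_T00 (by decide) z (by change (0:ℕ) = min 0 3; rfl) (by change (3:ℕ) = min sR 3; omega) (Or.inl (by change tD ≤ 0; omega)) (Or.inr (by decide)) (t1 := 0) (s1 := 3) (by omega) (by omega) (Or.inl (by omega)) (Or.inr (by norm_num)) wOK_1_T00⟩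
      · exact ⟨_, linkage_of_caseOK caseOK_1_T0p (by decide) z (by change (0:ℕ) = min 0 3; rfl) (by change (3:ℕ) = min sR 3; omega) (Or.inr (by decide)) (Or.inr (by decide)) (t1 := 1) (s1 := 3) (by omega) (by omega) (Or.inr (by norm_num)) (Or.inr (by norm_num)) wOK_1_T0p⟩
    · rcases Nat.lt_or_ge tD 2 with htD1 | htD1
      · exact ⟨_, linkage_of_caseOK caseOK_1_T11 (by decide) z (by change (1:ℕ) = min 1 3; rfl) (by change (3:ℕ) = min sR 3; omega) (Or.inl (by change tD ≤ 1; omega)) (Or.inr (by decide)) (t1 := 1) (s1 := 3) (by omega) (by omega) (Or.inr (by norm_num)) (Or.inr (by norm_num)) wOK_1_T11⟩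
      · exact ⟨_, linkage_of_caseOK caseOK_1_T1p (by decide) z (by change (1:ℕ) = min 1 3; rfl) (by change (3:ℕ) = min sR 3; omega) (Or.inr (by decide)) (Or.inr (by decide)) (t1 := 2) (s1 := 3) (by omega) (by omega) (Or.inr (by norm_num)) (Or.inr (by norm_num)) wOK_1_T1p⟩
    · rcases Nat.lt_or_ge tD 3 with htD1 | htD1
      · exact ⟨_, linkage_of_caseOK caseOK_1_T22 (by decide) z (by change (2:ℕ) = min 2 3; rfl) (by change (3:ℕ) = min sR 3; omega) (Or.inl (by change tD ≤ 2; omega)) (Or.inr (by decide)) (t1 := 2) (s1 := 3) (by omega) (by omega) (Or.inr (by norm_num)) (Or.inr (by norm_num)) wOK_1_T22⟩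
      · exact ⟨_, linkage_of_caseOK caseOK_1_T2p (by decide) z (by change (2:ℕ) = min 2 3; rfl) (by change (3:ℕ) = min sR 3; omega) (Or.inr (by decide)) (Or.inr (by decide)) (t1 := 3) (s1 := 3) (by omega) (by omega) (Or.inr (by norm_num)) (Or.inr (by norm_num)) wOK_1_T2p⟩
  · rcases Nat.lt_or_ge sR 3 with hsR3 | hsR3
    · interval_cases sR
      · rcases Nat.lt_or_ge sD 1 with hsD1 | hsD1
        · exact ⟨_, linkage_of_caseOK caseOK_1_S00 (by decide) z (by change (3:ℕ) = min tR 3; omega) (by change (0:ℕ) = min 0 3; rfl) (Or.inr (by decide)) (Or.inl (by change 0 ≤ 0; exact le_rfl)) (t1 := 3) (s1 := 0) (by omega) (by omega) (Or.inr (by norm_num)) (Or.inl (by omega)) wOK_1_S00⟩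
        · exact ⟨_, linkage_of_caseOK caseOK_1_S0p (by decide) z (by change (3:ℕ) = min tR 3; omega) (by change (0:ℕ) = min 0 3; rfl) (Or.inr (by decide)) (Or.inl (by change 0 ≤ 0; exact le_rfl)) (t1 := 3) (s1 := 1) (by omega) (by omega) (Or.inr (by norm_num)) (Or.inr (by norm_num)) wOK_1_S0p⟩
      · rcases Nat.lt_or_ge sD 2 with hsD1 | hsD1
        · exact ⟨_, linkage_of_caseOK caseOK_1_S11 (by decide) z (by change (3:ℕ) = min tR 3; omega) (by change (1:ℕ) = min 1 3; rfl) (Or.inr (by decide)) (Or.inl (by change 1 ≤ 1; exact le_rfl)) (t1 := 3) (s1 := 1) (by omega) (by omega) (Or.inr (by norm_num)) (Or.inr (by norm_num)) wOK_1_S11⟩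
        · exact ⟨_, linkage_of_caseOK caseOK_1_S1p (by decide) z (by change (3:ℕ) = min tR 3; omega) (by change (1:ℕ) = min 1 3; rfl) (Or.inr (by decide)) (Or.inl (by change 1 ≤ 1; exact le_rfl)) (t1 := 3) (s1 := 2) (by omega) (by omega) (Or.inr (by norm_num)) (Or.inr (by norm_num)) wOK_1_S1p⟩
      · rcases Nat.lt_or_ge sD 3 with hsD1 | hsD1
        · exact ⟨_, linkage_of_caseOK caseOK_1_S22 (by decide) z (by change (3:ℕ) = min tR 3; omega) (by change (2:ℕ) = min 2 3; rfl) (Or.inr (by decide)) (Or.inl (by change 2 ≤ 2; exact le_rfl)) (t1 := 3) (s1 := 2) (by omega) (by omega) (Or.inr (by norm_num)) (Or.inr (by norm_num)) wOK_1_S22⟩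
        · exact ⟨_, linkage_of_caseOK caseOK_1_S2p (by decide) z (by change (3:ℕ) = min tR 3; omega) (by change (2:ℕ) = min 2 3; rfl) (Or.inr (by decide)) (Or.inl (by change 2 ≤ 2; exact le_rfl)) (t1 := 3) (s1 := 3) (by omega) (by omega) (Or.inr (by norm_num)) (Or.inr (by norm_num)) wOK_1_S2p⟩
    · exact ⟨_, linkage_of_caseOK caseOK_1_U (by decide) z (by change (3:ℕ) = min tR 3; omega) (by change (3:ℕ) = min sR 3; omega) (Or.inr (by decide)) (Or.inr (by decide)) (t1 := 3) (s1 := 3) (by omega) (by omega) (Or.inr (by norm_num)) (Or.inr (by norm_num)) wOK_1_U⟩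

end TriFilm.SKT

/-- **SHAPED LOCAL LINKAGE OF THE TRIANGULAR FILM `𝕋 × {0..1}`, surgery radius `3`** — kernel-certified swap pairs in every clipped block
(«TriFilmSKDefs» … «TriFilmSKCase», certificates «TriFilmSKc1··»).  Independent of p205010. [cite: DuminilCopinSidoraviciusTassion2016, §2.3 (proof of Fact 2)] -/
theorem TriFilm.shapedLinkage_three_k1 : (TriFilm.hexShadow 1).ShapedLinkage 3 := by
  intro z tR tD sR sD htD hsD hone
  exact TriFilm.SKT.linkage_1 z tR tD sR sD htD hsD hone

/-- **THE TRIANGULAR FILM `𝕋 × {0..1}` DIES AT ITS OWN CRITICAL POINT at every vertex — independently of p205010** (Duminil-Copin–Sidoravicius–Tassion's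
slab argument transplanted to the hexagonal shadow; the instance's local linkage certified by the kernel).
[cite: DuminilCopinSidoraviciusTassion2016, Thm. 1, §2.3] [cite: BenjaminiSchramm1996, Conj. 4 / Question 3] -/
theorem TriFilm.theta_criticalProb_eq_zero_k1 (v : triFilm 1) : theta (TriFilm.film 1) v (criticalProbIOf (TriFilm.film 1) v) = 0 :=
  TriFilm.theta_criticalProb_eq_zero_of_shapedLinkage 1 TriFilm.shapedLinkage_three_k1 v

/-- **THE TRIANGULAR FILMS `𝕋 × {0..k}` DIE AT THEIR OWN CRITICAL POINT FOR EVERY `k` — independently of p205010**: `k = 0` is the triangular lattice (Wierman,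
«TriFilmZero»), `k = 1` by the kernel-certified local linkage (this file), `k ≥ 2` by the T‖ template («TriFilmLinkage», gen 33).  The by-name closure
«TriFilmCriticalContinuityAll».`TriFilm.theta_criticalProb_eq_zero_all` goes through p205010; this one does not.
[cite: DuminilCopinSidoraviciusTassion2016, Thm. 1, §2.3] [cite: Wierman1981, main theorem] [cite: BenjaminiSchramm1996, Conj. 4 / Question 3] -/
theorem TriFilm.theta_criticalProb_eq_zero_every (k : ℕ) (v : triFilm k) : theta (TriFilm.film k) v (criticalProbIOf (TriFilm.film k) v) = 0 := by
  rcases Nat.lt_or_ge k 2 with hk | hk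
  · interval_cases k
    · exact TriFilm.theta_criticalProb_eq_zero_k0 v
    · exact TriFilm.theta_criticalProb_eq_zero_k1 v
  · exact TriFilm.theta_criticalProb_eq_zero hk v

end Summit.CriticalPhenomena.PercolationContinuityZ3.Theorems.Transplant

end
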